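import Summits.NavierStokesRegularity.NavierStokesRegularity.Theorems.TerminalTraceTraceDensityCriterionTypeIZoomData
import Summits.NavierStokesRegularity.NavierStokesRegularity.Theorems.TerminalTraceTypeITraceScarL3StubExtinctApexOfL3Trace
import Summits.NavierStokesRegularity.NavierStokesRegularity.Theorems.TerminalTraceTypeITraceScarL3
import Literature.Analysis.FluidPDE.LocalPlainPressureBound
import Literature.Analysis.FluidPDE.NSViscosityRescaling
import Literature.Analysis.FluidPDE.NSLerayHopfABCScaling
import HarnessLib

/-!
# Crux `TerminalTrace.TraceDensityCriterion` (stmt-NavierStokesRegularity-18614): its TYPE-I-IN-TIME CELL holds —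
# a Type-I-in-time first singularity keeps positive scaled-energy density of the final value at every singular vertex

Seat nsreg-C26-p1 g6 (cell ns-regularity-ideate), `--supports stmt-NavierStokesRegularity-18614` (helper; nothing here
closes an item: the crux carries no Type-I hypothesis).  Route `TerminalTrace` of `NavierStokesRegularity`.

THE THEOREM (`TerminalTrace.typeI_traceDensityCriterion`).  In the frame of the route (`ν, T > 0`, `(u, p)` classical on
`[0, T) × ℝ³`, Leray–Hopf on `[0, T]`, rapidly decaying datum) and under the Type-I-in-time rate `IsTypeIBlowup u T`
(`‖u(t)‖_∞ ≤ C (T − t)^{-1/2}` near `T`): if the final value has no scaled-energy concentration at `x₀`,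
`r⁻¹ ∫_{B(x₀,r)} ‖u T‖² → 0` as `r → 0⁺` (FE(x₀)), then `(T, x₀)` is backward bounded
(`∃ r > 0, ∃ C, ‖u‖ ≤ C` on `(T − r², T) × B(x₀, r)` — verbatim the crux's inline conclusion, i.e.
`Literature.Analysis.FluidPDE.IsBackwardBoundedAt u T x₀`).  This is the statement of the crux `TraceDensityCriterion`
with the one extra hypothesis `IsTypeIBlowup u T`; it is STRICTLY STRONGER than the proved support item
`TypeITraceScarL3` (stmt-NavierStokesRegularity-18385, p650215), whose hypothesis `u T ∈ L³(B(x₀, ρ))` implies FE(x₀)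
by Hölder (`TypeITraceScarL3.tendsto_scaledEnergy_zero_of_memLp_three`).

THE ARGUMENT.  The landed 18385 chain, with its `L³` input replaced by FE(x₀) at the one place it was used:
* `TraceDensityCriterion.extinctApexD_unit_of_scaledEnergy` (`ν = 1`) — at a vertex that is NOT backward bounded,
  FE(x₀) and the Type-I rate produce an EXTINCT TYPE-I APEX `(U, P, G, M, D₀, C)`: suitable in every `Q(a)` with weak
  gradient, Albritton–Barker bound `𝐈(Q(a)) ≤ M`, plain pressure bound `cknD r z₀ P ≤ D₀` at every apex, rate
  `C/√(−s)`, weakly vanishing at the top time, backward-singular at the origin (the proof of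
  `TypeITraceScarL3.extinctApexD_of_L3trace_unit` verbatim over `exists_extinctApex_zoomData_unit_of_scaledEnergy`);
* `TraceDensityCriterion.extinctApexD_of_scaledEnergy` — every viscosity, by the normalisation `v(s, x) = ν⁻¹ u(s/ν, x)`
  (the proof of `TypeITraceScarL3.stub_extinctApexD_of_L3trace` verbatim; FE passes to `v(νT) = ν⁻¹ u(T)` by
  `SereginSverak2002.tendsto_scaledEnergy_const_smul`);
* `TerminalTrace.typeI_traceDensityCriterion` — NO extinct Type-I apex is backward-singular at the origin
  (`TypeITraceScarL3.no_singular_extinctApex`, the composition of line `radius_dichotomy`, p650215), so the vertex was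
  backward bounded after all;
* `TerminalTrace.typeI_not_tendsto_scaledEnergy_of_singular` — the contrapositive «density scar»: at a backward-singular vertex
  of a Type-I-in-time first singularity the final value does NOT have vanishing scaled energy.

WHAT THIS IS NOT: not NS regularity (Clay A), not the crux `TraceDensityCriterion` (open — no rate hypothesis there), not
`NoTraceConcentration`; a theorem about HYPOTHETICAL Type-I-in-time blow-ups.  [folklore; EscauriazaSereginSverak2003 §3,
Thms. 4.1, 5.1; AlbrittonBarker2019 §3; SereginSverak2002 §4; Seregin2014 §6.6]
-/

noncomputable section

set_option linter.dupNamespace false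

namespace Summit.NavierStokesRegularity.NavierStokesRegularity.Theorems

open MeasureTheory Set Function Filter Topology TopologicalSpace Metric
open Literature.Analysis.FluidPDE
open Summit.NavierStokesRegularity.NavierStokesRegularity.Theorems.TypeITraceScarL3
open scoped NNReal ENNReal InnerProductSpace RealInnerProductSpace

namespace TraceDensityCriterion

/-- **The extinct Type-I apex at a vertex with vanishing final scaled energy, unit viscosity.** `T > 0`, `(u, p)`
classical on `ℝ³ × [0, T)` (`ν = 1`) and Leray–Hopf on `[0, T]`, Type-I in time, NOT backward bounded at `(T, x₀)`,
with `r⁻¹ ∫_{B(x₀,r)} ‖u T‖² → 0`: then there is an extinct Type-I apex `(U, P, G, M, D₀, C)` — suitable in every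
`Q(a)` with weak gradient `G`, `𝐈(Q(a)) ≤ M`, PLAIN `D(Q_r(z₀))[P] ≤ D₀` at every apex `z₀.1 ≤ 0` and every radius,
rate `C/√(−s)` a.e. on every slice, weakly vanishing at the top time, backward-singular at the origin.
[folklore; AlbrittonBarker2019 §3; SereginSverak2009 (as13); WangZhang2016 §4; Seregin2014 §6.6] -/
theorem extinctApexD_unit_of_scaledEnergy {T : ℝ} (hT : 0 < T)
    {u : ℝ → EuclideanSpace ℝ (Fin 3) → EuclideanSpace ℝ (Fin 3)} {p : ℝ → EuclideanSpace ℝ (Fin 3) → ℝ}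
    (hsol : IsClassicalNSSolutionOn (Ico 0 T) 1 0 u p) (hLH : IsLerayHopfOn T 1 0 (u 0) u)
    (hI : IsTypeIBlowup u T) (x₀ : EuclideanSpace ℝ (Fin 3)) (hnotbd : ¬ IsBackwardBoundedAt u T x₀)
    (hFE : Tendsto (fun r : ℝ => r⁻¹ * ∫ x in ball x₀ r, ‖u T x‖ ^ 2) (𝓝[>] 0) (𝓝 0)) :
    ∃ (U : ℝ → EuclideanSpace ℝ (Fin 3) → EuclideanSpace ℝ (Fin 3)) (P : ℝ → EuclideanSpace ℝ (Fin 3) → ℝ)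
      (G : ℝ → EuclideanSpace ℝ (Fin 3) → EuclideanSpace ℝ (Fin 3) →L[ℝ] EuclideanSpace ℝ (Fin 3))
      (M D₀ : ℝ≥0) (C : ℝ),
      (∀ a : ℝ, 0 < a → IsSuitableWeakSolutionInBall a (0 : ℝ × EuclideanSpace ℝ (Fin 3)) U P) ∧
      (∀ a : ℝ, 0 < a →
        HasWeakSpatialGradientOn (parabolicCylinderOpens a (0 : ℝ × EuclideanSpace ℝ (Fin 3))) U G) ∧
      (∀ a : ℝ, 0 < a → typeIBound (parabolicCylinder a (0 : ℝ × EuclideanSpace ℝ (Fin 3))) U P G ≤ M) ∧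
      (∀ z₀ : ℝ × EuclideanSpace ℝ (Fin 3), z₀.1 ≤ 0 → ∀ r : ℝ, 0 < r → cknD r z₀ P ≤ D₀) ∧
      (∀ s : ℝ, s < 0 → ∀ᵐ y : EuclideanSpace ℝ (Fin 3), ‖U s y‖ ≤ C / Real.sqrt (-s)) ∧
      (∀ φ : EuclideanSpace ℝ (Fin 3) → EuclideanSpace ℝ (Fin 3), ContDiff ℝ (⊤ : ℕ∞) φ →
        HasCompactSupport φ → ∀ ε : ℝ, 0 < ε →
          ∃ s₀ : ℝ, s₀ < 0 ∧ ∀ᵐ s ∂(volume.restrict (Ioo s₀ 0)), |∫ y, ⟪U s y, φ y⟫| ≤ ε) ∧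
      IsBackwardSingularPoint U (0 : ℝ × EuclideanSpace ℝ (Fin 3)) := by
  -- adapted VERBATIM from …/TerminalTraceTypeITraceScarL3ExtinctApexPressureUnit.lean (`extinctApexD_of_L3trace_unit`)
  -- ## (1) the apex with its zoom data
  obtain ⟨μ, U, P, G, M, C, hμ, hμ0, h1, h2, h3, h4, h5, h6, hdata⟩ :=
    exists_extinctApex_zoomData_unit_of_scaledEnergy hT hsol hLH hI x₀ hnotbd hFE
  -- ## (2) the vertex frame: `v = R u(T + R²·, x₀ + R·)`, `πv = R² q(…)`, with `𝐈(Q(0,1/2)) < ⊤`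
  obtain ⟨r₀, M₀, T₁, hr₀, hT₁, hMor⟩ := morrey_of_typeI one_pos hT hsol hLH hI
  obtain ⟨R, α, β, hR, hα, hβ, hβeq, hαeq, hβT, hball, hGv, htypeI⟩ :=
    exists_zoom_typeIBound_lt_top_of_morrey one_pos hT hsol hLH hr₀ hT₁ hMor x₀
  rw [div_one] at hβeq hαeq
  set q : ℝ → EuclideanSpace ℝ (Fin 3) → ℝ :=
    fun t x => p t x - (p t 0 - normalisedPressure (u t) 0) with hq
  set v : ℝ → EuclideanSpace ℝ (Fin 3) → EuclideanSpace ℝ (Fin 3) := α • stPull β R T x₀ u with hv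
  set πv : ℝ → EuclideanSpace ℝ (Fin 3) → ℝ := α ^ 2 • stPull β R T x₀ q with hπv
  set Gv : ℝ → EuclideanSpace ℝ (Fin 3) → EuclideanSpace ℝ (Fin 3) →L[ℝ] EuclideanSpace ℝ (Fin 3) :=
    (α * R) • stPull β R T x₀ (fun t x => fderiv ℝ (u t) x) with hGvdef
  have hπv1 : πv = R ^ 2 • stPull (R ^ 2) R T x₀ q := by rw [hπv, hαeq, hβeq]
  set z₀ : ℝ × EuclideanSpace ℝ (Fin 3) := ((0 : ℝ), (0 : EuclideanSpace ℝ (Fin 3))) with hz₀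
  have hz₀0 : z₀ = 0 := rfl
  -- the distributional pair on `Q(0,1)` and the sub-cylinder `Q(0, 1/2)`
  have hdist : IsDistributionalNSSolutionOn
      (parabolicCylinderOpens 1 (0 : ℝ × EuclideanSpace ℝ (Fin 3))) 1 0 v πv := hball.1.distributional
  have hsub : parabolicCylinder (1 / 2) z₀ ⊆
      ((parabolicCylinderOpens 1 (0 : ℝ × EuclideanSpace ℝ (Fin 3)) :
        Opens (ℝ × EuclideanSpace ℝ (Fin 3))) : Set (ℝ × EuclideanSpace ℝ (Fin 3))) := by
    rw [coe_parabolicCylinderOpens, hz₀0]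
    exact SuitableCompactness.parabolicCylinder_zero_mono (by norm_num) (by norm_num)
  -- `M₁ = 𝐈(Q(0, 1/2))` bounds `C` on every sub-cylinder
  set M₁ : ℝ≥0∞ := typeIBound (parabolicCylinder (1 / 2) (0 : ℝ × EuclideanSpace ℝ (Fin 3))) v πv Gv
    with hM₁
  have hM₁top : M₁ ≠ ⊤ := htypeI.ne
  have hC : ∀ (z : ℝ × EuclideanSpace ℝ (Fin 3)) (r : ℝ), 0 < r →
      parabolicCylinder r z ⊆ parabolicCylinder (1 / 2) z₀ → cknC r z v ≤ M₁ := by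
    intro z r hr hz
    rw [hz₀0] at hz
    exact cknC_le_of_typeIBound_le (le_refl M₁) subset_rfl hr hz
  -- `M₂ = D(Q(0, 1/2))[πv]` is finite (`πv ∈ L^{3/2}(Q(0,1))`)
  set M₂ : ℝ≥0∞ := cknD (1 / 2) z₀ πv with hM₂
  have hM₂top : M₂ ≠ ⊤ := by
    obtain ⟨h32, h32', h32r⟩ := threeHalves_facts
    have hm : MemLp (uncurry πv) (3 / 2)
        (volume.restrict (parabolicCylinder 1 (0 : ℝ × EuclideanSpace ℝ (Fin 3)))) := hball.2.2.2
    have h2 := hm.2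
    rw [eLpNorm_eq_lintegral_rpow_enorm_toReal (by norm_num) h32', h32r] at h2
    have hfin : ∫⁻ z in parabolicCylinder 1 (0 : ℝ × EuclideanSpace ℝ (Fin 3)),
        ‖uncurry πv z‖ₑ ^ (3 / 2 : ℝ) < ⊤ := by
      by_contra htop
      rw [not_lt, top_le_iff] at htop
      rw [htop, ENNReal.top_rpow_of_pos (by norm_num)] at h2
      exact lt_irrefl _ h2
    have hfin' : ∫⁻ z in parabolicCylinder (1 / 2) z₀, ‖πv z.1 z.2‖ₑ ^ (3 / 2 : ℝ) < ⊤ := by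
      refine lt_of_le_of_lt (lintegral_mono_set ?_) hfin
      rw [hz₀0]
      exact SuitableCompactness.parabolicCylinder_zero_mono (by norm_num) (by norm_num)
    rw [hM₂, cknD]
    exact ENNReal.mul_ne_top (ENNReal.inv_ne_top.2 (pow_ne_zero _ (by simp))) hfin'.ne
  -- ## (3) Seregin–Šverák's iterated pressure decay: plain `D ≤ κ(M₁ + M₂)` on the window
  obtain ⟨κ, hκ⟩ := exists_cknD_le_window_of_cknC_le
  set K : ℝ≥0∞ := κ * (M₁ + M₂) with hK
  have hKtop : K ≠ ⊤ := ENNReal.mul_ne_top ENNReal.coe_ne_top (ENNReal.add_ne_top.2 ⟨hM₁top, hM₂top⟩)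
  have hwin : ∀ z : ℝ × EuclideanSpace ℝ (Fin 3), z.1 ≤ z₀.1 → z₀.1 - 3 / 16 ≤ z.1 →
      dist z.2 z₀.2 < 1 / 4 → ∀ r ∈ Ioc (0 : ℝ) (1 / 4), cknD r z πv ≤ K := by
    intro z hz1 hz2 hz3 r hr
    have h := hκ (parabolicCylinderOpens 1 (0 : ℝ × EuclideanSpace ℝ (Fin 3))) v πv hdist z₀ (1 / 2)
      (by norm_num) hsub M₁ M₂ hC le_rfl z hz1 (by norm_num at hz2 ⊢; linarith) (by norm_num; exact hz3)
      r ⟨hr.1, by norm_num; exact hr.2⟩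
    rw [hK]
    exact h
  -- ## (4) the zoomed pressures of the zoom data are `(μ_j/R)`-zooms of `πv`
  set lam : ℕ → ℝ := fun j => μ j / R with hlam
  have hlampos : ∀ j, 0 < lam j := fun j => show 0 < μ j / R from div_pos (hμ j) hR
  have hlam0 : Tendsto lam atTop (𝓝 0) := by
    have := hμ0.div_const R
    rwa [zero_div] at this
  have hzoomπ : ∀ j, (lam j) ^ 2 • stPull ((lam j) ^ 2) (lam j) z₀.1 z₀.2 πv =
      (μ j) ^ 2 • stPull ((μ j) ^ 2) (μ j) T x₀ q := by
    intro j
    have e : lam j * R = μ j := by rw [hlam]; field_simp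
    show (lam j) ^ 2 • stPull ((lam j) ^ 2) (lam j) (0 : ℝ) (0 : EuclideanSpace ℝ (Fin 3)) πv = _
    rw [hπv1, zoom_zoom_pressure, e]
  have hpm : AEStronglyMeasurable (uncurry πv) (volume.restrict (parabolicCylinder (1 / 2) z₀)) :=
    hball.2.2.2.1.mono_measure (Measure.restrict_mono (by rwa [coe_parabolicCylinderOpens] at hsub) le_rfl)
  have hπ : ∀ a : ℝ, 0 < a → MemLp (uncurry P) (3 / 2)
      (volume.restrict (parabolicCylinder a (0 : ℝ × EuclideanSpace ℝ (Fin 3)))) :=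
    fun a ha => (hdata a ha).2.1
  have hweak : ∀ a : ℝ, 0 < a → ∀ g : ℝ × EuclideanSpace ℝ (Fin 3) → ℝ,
      MemLp g 3 (volume.restrict (parabolicCylinder a (0 : ℝ × EuclideanSpace ℝ (Fin 3)))) →
      Tendsto (fun j => ∫ w' in parabolicCylinder a (0 : ℝ × EuclideanSpace ℝ (Fin 3)),
          ((lam j) ^ 2 • stPull ((lam j) ^ 2) (lam j) z₀.1 z₀.2 πv) w'.1 w'.2 * g w')
        atTop (𝓝 (∫ w' in parabolicCylinder a (0 : ℝ × EuclideanSpace ℝ (Fin 3)), P w'.1 w'.2 * g w')) := by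
    intro a ha g hg
    simp only [hzoomπ]
    exact (hdata a ha).2.2.2 g hg
  -- ## (5) weak lower semicontinuity: the limit pressure inherits `D ≤ K` at every apex
  have hvi : ∀ z : ℝ × EuclideanSpace ℝ (Fin 3), z.1 ≤ 0 → ∀ r : ℝ, 0 < r → cknD r z P ≤ K :=
    fun z hz r hr => blowup_cknD_le_apex_of_tendsto hpm (by norm_num : (0 : ℝ) < 3 / 16)
      (by norm_num : (0 : ℝ) < 1 / 4) (by norm_num : (0 : ℝ) < 1 / 4) hwin hlampos hlam0 hπ hweak hz hr
  -- ## (6) assemble, with `D₀ = K` as a finite constant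
  refine ⟨U, P, G, M, K.toNNReal, C, h1, h2, h3, ?_, h4, h5, h6⟩
  intro z hz r hr
  rw [ENNReal.coe_toNNReal hKtop]
  exact hvi z hz r hr

/-- **The extinct Type-I apex at a vertex with vanishing final scaled energy, every viscosity.**  In the frame
(`ν, T > 0`, classical on `[0, T)`, Leray–Hopf on `[0, T]`), Type-I in time, at a vertex `(T, x₀)` which is NOT
backward bounded and where `r⁻¹ ∫_{B(x₀,r)} ‖u T‖² → 0`, there is an extinct Type-I apex with all seven clauses of
`extinctApexD_unit_of_scaledEnergy` (viscosity normalisation `v(s, x) = ν⁻¹ u(s/ν, x)`, blow-up time `νT`).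
[folklore; AlbrittonBarker2019 §3 Rem. 3.2; Seregin2014 §6.6 Prop. 6.20] -/
theorem extinctApexD_of_scaledEnergy {ν T : ℝ} (hν : 0 < ν) (hT : 0 < T)
    {u : ℝ → EuclideanSpace ℝ (Fin 3) → EuclideanSpace ℝ (Fin 3)} {p : ℝ → EuclideanSpace ℝ (Fin 3) → ℝ}
    (hcl : IsClassicalNSSolutionOn (Ico 0 T) ν 0 u p) (hLH : IsLerayHopfOn T ν 0 (u 0) u)
    (hI : IsTypeIBlowup u T) (x₀ : EuclideanSpace ℝ (Fin 3)) (hnotbd : ¬ IsBackwardBoundedAt u T x₀)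
    (hFE : Tendsto (fun r : ℝ => r⁻¹ * ∫ x in ball x₀ r, ‖u T x‖ ^ 2) (𝓝[>] 0) (𝓝 0)) :
    ∃ (U : ℝ → EuclideanSpace ℝ (Fin 3) → EuclideanSpace ℝ (Fin 3)) (P : ℝ → EuclideanSpace ℝ (Fin 3) → ℝ)
      (G : ℝ → EuclideanSpace ℝ (Fin 3) → EuclideanSpace ℝ (Fin 3) →L[ℝ] EuclideanSpace ℝ (Fin 3))
      (M D₀ : ℝ≥0) (C : ℝ),
      (∀ a : ℝ, 0 < a → IsSuitableWeakSolutionInBall a (0 : ℝ × EuclideanSpace ℝ (Fin 3)) U P) ∧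
      (∀ a : ℝ, 0 < a →
        HasWeakSpatialGradientOn (parabolicCylinderOpens a (0 : ℝ × EuclideanSpace ℝ (Fin 3))) U G) ∧
      (∀ a : ℝ, 0 < a → typeIBound (parabolicCylinder a (0 : ℝ × EuclideanSpace ℝ (Fin 3))) U P G ≤ M) ∧
      (∀ z₀ : ℝ × EuclideanSpace ℝ (Fin 3), z₀.1 ≤ 0 → ∀ r : ℝ, 0 < r → cknD r z₀ P ≤ D₀) ∧
      (∀ s : ℝ, s < 0 → ∀ᵐ y : EuclideanSpace ℝ (Fin 3), ‖U s y‖ ≤ C / Real.sqrt (-s)) ∧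
      (∀ φ : EuclideanSpace ℝ (Fin 3) → EuclideanSpace ℝ (Fin 3), ContDiff ℝ (⊤ : ℕ∞) φ →
        HasCompactSupport φ → ∀ ε : ℝ, 0 < ε →
          ∃ s₀ : ℝ, s₀ < 0 ∧ ∀ᵐ s ∂(volume.restrict (Ioo s₀ 0)), |∫ y, ⟪U s y, φ y⟫| ≤ ε) ∧
      IsBackwardSingularPoint U (0 : ℝ × EuclideanSpace ℝ (Fin 3)) := by
  -- adapted VERBATIM from …/TerminalTraceTypeITraceScarL3StubExtinctApexDOfL3Trace.lean (`stub_extinctApexD_of_L3trace`)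
  have hν0 : ν ≠ 0 := hν.ne'
  have hνi : 0 < ν⁻¹ := inv_pos.2 hν
  have hνT : 0 < ν * T := mul_pos hν hT
  -- ## viscosity normalisation `v(s, x) = ν⁻¹ u(s/ν, x)`, blow-up time `νT`
  set v : ℝ → EuclideanSpace ℝ (Fin 3) → EuclideanSpace ℝ (Fin 3) := timeRescale ν⁻¹ ν⁻¹ u with hv
  set pv : ℝ → EuclideanSpace ℝ (Fin 3) → ℝ := timeRescale ν⁻¹ (ν⁻¹ ^ 2) p with hpv
  have hmaps : MapsTo (fun s => ν⁻¹ * s) (Ico 0 (ν * T)) (Ico 0 T) := by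
    intro s hs
    refine ⟨mul_nonneg hνi.le hs.1, ?_⟩
    calc ν⁻¹ * s < ν⁻¹ * (ν * T) := mul_lt_mul_of_pos_left hs.2 hνi
      _ = T := by rw [← mul_assoc, inv_mul_cancel₀ hν0, one_mul]
  -- (1) classical at viscosity 1 on `[0, νT)`
  have hclv : IsClassicalNSSolutionOn (Ico 0 (ν * T)) 1 0 v pv := by
    have h := hcl.viscosityRescale_set hν0 hmaps (uniqueDiffOn_Ico 0 (ν * T))
    rwa [timeRescale_zero_force] at h
  -- (2) Leray–Hopf on `[0, νT]`
  have hv0 : ν⁻¹ • u 0 = v 0 := by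
    funext x
    simp [hv]
  have hLHv : IsLerayHopfOn (ν * T) 1 0 (v 0) v := by
    have h := hLH.viscosityRescale hνi
    have e1 : T / ν⁻¹ = ν * T := by rw [div_inv_eq_mul, mul_comm]
    rwa [e1, inv_mul_cancel₀ hν0, timeRescale_zero_force, hv0] at h
  -- (3) the Type-I rate
  have hIv : IsTypeIBlowup v (ν * T) := by
    obtain ⟨C, hC⟩ := hI
    have e0 : ν⁻¹ * (ν * T) = T := by rw [← mul_assoc, inv_mul_cancel₀ hν0, one_mul]
    have htend : Tendsto (fun s : ℝ => ν⁻¹ * s) (𝓝[<] (ν * T)) (𝓝[<] T) := by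
      refine tendsto_nhdsWithin_of_tendsto_nhds_of_eventually_within _ ?_ ?_
      · have h := ((continuous_const_mul ν⁻¹).tendsto (ν * T)).mono_left
          (nhdsWithin_le_nhds (s := Iio (ν * T)))
        rwa [e0] at h
      · refine eventually_nhdsWithin_of_forall fun s hs => ?_
        have h := mul_lt_mul_of_pos_left (mem_Iio.1 hs) hνi
        rwa [e0] at h
    refine ⟨C / Real.sqrt ν, ?_⟩
    filter_upwards [htend.eventually hC, self_mem_nhdsWithin] with s hs hsT x
    have hsT' : s < ν * T := hsT
    have hpos : 0 < ν * T - s := sub_pos.2 hsT'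
    have e : T - ν⁻¹ * s = ν⁻¹ * (ν * T - s) := by field_simp
    have hsq : Real.sqrt (T - ν⁻¹ * s) = (Real.sqrt ν)⁻¹ * Real.sqrt (ν * T - s) := by
      rw [e, Real.sqrt_mul hνi.le, Real.sqrt_inv]
    have hb := hs x
    rw [hsq] at hb
    have hsν : 0 < Real.sqrt ν := Real.sqrt_pos.2 hν
    have hsνsq : Real.sqrt ν * Real.sqrt ν = ν := Real.mul_self_sqrt hν.le
    have hsqpos : 0 < Real.sqrt (ν * T - s) := Real.sqrt_pos.2 hpos
    rw [le_div_iff₀ (by positivity)] at hb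
    have hνinv : ν⁻¹ = (Real.sqrt ν)⁻¹ * (Real.sqrt ν)⁻¹ := by rw [← mul_inv, hsνsq]
    have key : ν⁻¹ * ‖u (ν⁻¹ * s) x‖ ≤ C / Real.sqrt ν / Real.sqrt (ν * T - s) := by
      rw [le_div_iff₀ hsqpos]
      calc ν⁻¹ * ‖u (ν⁻¹ * s) x‖ * Real.sqrt (ν * T - s)
          = (Real.sqrt ν)⁻¹ * (‖u (ν⁻¹ * s) x‖ * ((Real.sqrt ν)⁻¹ * Real.sqrt (ν * T - s))) := by
              rw [hνinv]; ring
        _ ≤ (Real.sqrt ν)⁻¹ * C := mul_le_mul_of_nonneg_left hb (inv_nonneg.2 hsν.le)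
        _ = C / Real.sqrt ν := by rw [div_eq_inv_mul]
    have e2 : ‖v s x‖ = ν⁻¹ * ‖u (ν⁻¹ * s) x‖ := by
      rw [hv, timeRescale_apply, norm_smul, Real.norm_eq_abs, abs_of_pos hνi]
    exact e2 ▸ key
  -- (4) the vertex is not backward bounded for `v`
  have hnotbdv : ¬ IsBackwardBoundedAt v (ν * T) x₀ := not_isBackwardBoundedAt_viscosityRescale hν hnotbd
  -- (5) the scaled energy of the final value `v(νT) = ν⁻¹ u(T)` vanishes at `x₀`
  have hFEv : Tendsto (fun r : ℝ => r⁻¹ * ∫ x in ball x₀ r, ‖v (ν * T) x‖ ^ 2) (𝓝[>] 0) (𝓝 0) := by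
    have e : v (ν * T) = ν⁻¹ • u T := by
      funext x
      rw [hv, timeRescale_apply, ← mul_assoc, inv_mul_cancel₀ hν0, one_mul, Pi.smul_apply]
    rw [e]
    exact SereginSverak2002.tendsto_scaledEnergy_const_smul hFE ν⁻¹
  -- ## the unit-viscosity theorem
  exact extinctApexD_unit_of_scaledEnergy hνT hclv hLHv hIv x₀ hnotbdv hFEv

end TraceDensityCriterion

/-- **THE TYPE-I-IN-TIME CELL OF THE CRUX `TraceDensityCriterion` (stmt-NavierStokesRegularity-18614).**  In the frame
of route `TerminalTrace` (`ν, T > 0`, `(u, p)` classical on `[0, T) × ℝ³`, Leray–Hopf on `[0, T]`, rapidly decaying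
datum), under the Type-I-in-time rate `IsTypeIBlowup u T`: if the final value has no scaled-energy concentration at
`x₀` (`r⁻¹ ∫_{B(x₀,r)} ‖u T‖² → 0`), then `u` is bounded on some backward cylinder `(T − r², T) × B(x₀, r)` — the
crux's statement verbatim with the one extra hypothesis `IsTypeIBlowup u T`.  Proof: otherwise
`TraceDensityCriterion.extinctApexD_of_scaledEnergy` produces an extinct Type-I apex backward-singular at the origin,
and there is none (`TypeITraceScarL3.no_singular_extinctApex`).
[folklore; EscauriazaSereginSverak2003 §3; AlbrittonBarker2019 §3; SereginSverak2002 §4 (4.8)] -/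
theorem TerminalTrace.typeI_traceDensityCriterion :
    ∀ (ν T : ℝ), 0 < ν → 0 < T →
      ∀ (u : ℝ → EuclideanSpace ℝ (Fin 3) → EuclideanSpace ℝ (Fin 3)) (p : ℝ → EuclideanSpace ℝ (Fin 3) → ℝ),
      IsClassicalNSSolutionOn (Ico 0 T) ν 0 u p → IsLerayHopfOn T ν 0 (u 0) u →
      HasRapidSpatialDecay (u 0) → IsTypeIBlowup u T → ∀ x₀ : EuclideanSpace ℝ (Fin 3),
      Tendsto (fun r : ℝ => r⁻¹ * ∫ x in ball x₀ r, ‖u T x‖ ^ 2) (𝓝[>] 0) (𝓝 0) →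
      ∃ r > 0, ∃ C : ℝ, ∀ t ∈ Ioo (T - r ^ 2) T, ∀ x ∈ ball x₀ r, ‖u t x‖ ≤ C := by
  intro ν T hν hT u p hcl hLH _hdec hTI x₀ hFE
  by_contra hnotbd
  obtain ⟨U, P, G, M, D₀, C, hsw, hG, hI, hD, hrate, htop, hsingU⟩ :=
    TraceDensityCriterion.extinctApexD_of_scaledEnergy hν hT hcl hLH hTI x₀ hnotbd hFE
  exact TypeITraceScarL3.no_singular_extinctApex U P G M D₀ C hsw hG hI hD hrate htop hsingU

/-- **The density scar of a Type-I-in-time singularity** (contrapositive of `TerminalTrace.typeI_traceDensityCriterion`,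
in the singular-vertex vocabulary of the route): in the frame, under `IsTypeIBlowup u T`, at a backward-singular vertex
`(T, x₀)` (`u` essentially unbounded on every `Q_r(T, x₀)`) the scaled energy of the final value does NOT tend to zero,
`¬ (r⁻¹ ∫_{B(x₀,r)} ‖u T‖² → 0)`.  With Hölder (`TypeITraceScarL3.tendsto_scaledEnergy_zero_of_memLp_three`) this
re-derives the proved support item `TypeITraceScarL3` (stmt-NavierStokesRegularity-18385; not restated here — it is
`terminalTrace_typeITraceScarL3_proof`).
[folklore; EscauriazaSereginSverak2003 §3; AlbrittonBarker2019 §3] -/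
theorem TerminalTrace.typeI_not_tendsto_scaledEnergy_of_singular {ν T : ℝ} (hν : 0 < ν) (hT : 0 < T)
    {u : ℝ → EuclideanSpace ℝ (Fin 3) → EuclideanSpace ℝ (Fin 3)} {p : ℝ → EuclideanSpace ℝ (Fin 3) → ℝ}
    (hcl : IsClassicalNSSolutionOn (Ico 0 T) ν 0 u p) (hLH : IsLerayHopfOn T ν 0 (u 0) u)
    (hdec : HasRapidSpatialDecay (u 0)) (hI : IsTypeIBlowup u T) {x₀ : EuclideanSpace ℝ (Fin 3)}
    (hsing : ∀ r : ℝ, 0 < r → eLpNorm (uncurry u) ⊤ (volume.restrict (parabolicCylinder r (T, x₀))) = ⊤) :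
    ¬ Tendsto (fun r : ℝ => r⁻¹ * ∫ x in ball x₀ r, ‖u T x‖ ^ 2) (𝓝[>] 0) (𝓝 0) := by
  intro hFE
  have hbb : IsBackwardBoundedAt u T x₀ :=
    TerminalTrace.typeI_traceDensityCriterion ν T hν hT u p hcl hLH hdec hI x₀ hFE
  obtain ⟨r, hr, hfin⟩ := hbb.eLpNorm_parabolicCylinder_lt_top
  exact hfin.ne (hsing r hr)

end Summit.NavierStokesRegularity.NavierStokesRegularity.Theorems

end
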